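import Summits.QuantumFields.YangMills.Theorems.UnitScaleTiltFluctuationComparisonRegPrIntLT8OfV7Leaves
import Summits.QuantumFields.YangMills.Theorems.AlphaInputsT3ACMinimiserPinThm1
import HarnessLib

/-!
# `UnitScaleTiltFluctuationComparisonRegPrIntLTOfV7Leaves` — THE REGISTERED VARIATIONAL STUB T OF SKELETON v5k («[Balaban1985Variational] Thm 1 + Prop 7 in the tree's
# global reading, `T3PrintedMinimiserExistence.Thm1GlobalMin L`, at every odd block size») FROM STUB T8 OF THE v5kC PEN, AND HENCE FROM THE TWO OPEN LEAVES OF CRUX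
# `MinimiserStabilityRegPr`'s REGISTERED SKELETON v7, BY NAME (crux `FluctuationComparisonRegPrIntL` stmt-QuantumFields-20520 — skeleton OF RECORD v5k
# `Cruxes/FluctuationComparisonRegPrIntL/Lines/birth_v5k.lean` 3b016214180ca501, stub `stub_thm1GlobalMin`; pen v5kC, stub `stub_thm1In8GlobalMin` — and crux
# `MinimiserStabilityRegPr` stmt-QuantumFields-19200 — skeleton v7 `Cruxes/MinimiserStabilityRegPr/Lines/birth_v7.lean` cc37a17877262141, stubs `stub_halvingStep` (V2′),
# `stub_prop7From14` (V3); width seat ym-ust-20520-w3 g0; YM₃ on the 3-torus is ladder rung R3, not the Clay problem)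

★r1 g4's `InteriorExcision.thm1In8GlobalMin_of_v7Leaves` (`…IntLT8OfV7Leaves`) composes 19200's two open leaves into the text of the PEN's stub T8
(`∃ a₀ a₁ B₃ > 0, Thm1GlobalMinAt L a₀ a₁ B₃ ∧ MinimisersIn8At L a₀ a₁ B₃`).  The skeleton OF RECORD today is v5k, whose variational stub is T:
`∀ L, Odd L → 1 < L → T3PrintedMinimiserExistence.Thm1GlobalMin L`, i.e. `∃ a₀ a₁ B₃ > 0, B₃·a₁ ≤ a₀ ∧ Thm1GlobalMinAt L a₀ a₁ B₃` — it carries the printed side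
condition `B₃a₁ ≤ a₀` that T8 does not display.  This file supplies the two-line bookkeeping so that BOTH variational stubs close by name the day 19200's leaves
close, whichever skeleton is of record:

* `thm1GlobalMin_of_thm1In8At` — T8's text at one `L` ⟹ `Thm1GlobalMin L` (shrink `a₁` to `min a₁ (a₀/B₃)`; `Thm1GlobalMinAt` is antitone in `a₁`,
  `MinimiserPin.thm1GlobalMinAt_anti`);
* `thm1GlobalMin_of_thm1In8` — ⟨stub_thm1In8GlobalMin TEXT⟩ ⟹ ⟨stub_thm1GlobalMin TEXT⟩ (v5kC's T8 subsumes v5k's T);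
* **`thm1GlobalMin_of_v7Leaves : ⟨stub_halvingStep TEXT⟩ → ⟨stub_prop7From14 TEXT⟩ → ⟨stub_thm1GlobalMin TEXT⟩`** (the registered T of v5k VERBATIM, from v7's two
  registered leaves VERBATIM, through ★r1 g4's T8 composition).
CONDITIONAL compositions; nothing of [Balaban1985Variational] is asserted; registry untouched (`--supports stmt-QuantumFields-20520`).

References: T. Bałaban, CMP 102 (1985) 277–309 [Balaban1985Variational] (Thm 1 (6)–(8) pp.278–279, Prop. 7 p.299, Sect. F / Prop. 8 p.304).
-/

set_option autoImplicit false

noncomputable section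

namespace Summit.QuantumFields.YangMills.Theorems.InteriorExcision

open Literature.MathematicalPhysics.QuantumFieldTheory.Balaban1983to89
open Literature.MathematicalPhysics.QuantumFieldTheory.Balaban1983to89.T3ContinuumYM3Torus
open Literature.MathematicalPhysics.QuantumFieldTheory.Balaban1983to89.T3PrintedMinimiserExistence
open Literature.MathematicalPhysics.QuantumFieldTheory.Balaban1983to89.T3LowerAlongMinimisersSplit (MinimisersIn8At)
open Literature.MathematicalPhysics.QuantumFieldTheory.Balaban1983to89.T3Thm1Carrier (famX Idx)

/-- **T8's TEXT AT ONE BLOCK SIZE ⟹ `Thm1GlobalMin L`.**  From `0 < a₀, a₁, B₃` and `Thm1GlobalMinAt L a₀ a₁ B₃` (the (8)-clause is not used), the printed quantifier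
shape `∃ a₀ a₁ B₃ > 0, B₃a₁ ≤ a₀ ∧ Thm1GlobalMinAt L a₀ a₁ B₃` holds at `a₁' := min a₁ (a₀ / B₃)`: `Thm1GlobalMinAt` is antitone in `a₁` (fewer admissible `ε₁`),
and `B₃ · min a₁ (a₀/B₃) ≤ a₀`.  Bookkeeping only. [cite: Balaban1985Variational, Thm 1 (8) p.279 («B₃a₁ ≤ a₀») and Prop. 7 p.299] -/
theorem thm1GlobalMin_of_thm1In8At {L : ℕ}
    (h : ∃ a₀ a₁ B₃ : ℝ, 0 < a₀ ∧ 0 < a₁ ∧ 0 < B₃ ∧ Thm1GlobalMinAt L a₀ a₁ B₃ ∧ MinimisersIn8At L a₀ a₁ B₃) :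
    Thm1GlobalMin L := by
  obtain ⟨a₀, a₁, B₃, ha₀, ha₁, hB₃, hT, -⟩ := h
  refine ⟨a₀, min a₁ (a₀ / B₃), B₃, ha₀, lt_min ha₁ (div_pos ha₀ hB₃), hB₃, ?_,
    MinimiserPin.thm1GlobalMinAt_anti hT le_rfl (min_le_left _ _)⟩
  calc B₃ * min a₁ (a₀ / B₃) ≤ B₃ * (a₀ / B₃) := mul_le_mul_of_nonneg_left (min_le_right _ _) hB₃.le
    _ = a₀ := by field_simp

/-- **⟨stub_thm1In8GlobalMin TEXT⟩ (v5kC's T8) ⟹ ⟨stub_thm1GlobalMin TEXT⟩ (v5k's T)**, block size by block size (`thm1GlobalMin_of_thm1In8At`).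
[cite: Balaban1985Variational, Thm 1 (8) p.279 and Prop. 7 p.299] -/
theorem thm1GlobalMin_of_thm1In8
    (hT8 : ∀ L : ℕ, Odd L → 1 < L → ∃ a₀ a₁ B₃ : ℝ, 0 < a₀ ∧ 0 < a₁ ∧ 0 < B₃ ∧
      Thm1GlobalMinAt L a₀ a₁ B₃ ∧ MinimisersIn8At L a₀ a₁ B₃) :
    ∀ L : ℕ, Odd L → 1 < L → T3PrintedMinimiserExistence.Thm1GlobalMin L :=
  fun L hLo hL => thm1GlobalMin_of_thm1In8At (hT8 L hLo hL)

/-- **THE REGISTERED STUB T OF v5k FROM THE TWO OPEN LEAVES OF `MinimiserStabilityRegPr`'s v7, BY NAME.**  Hypotheses = the registered texts of `stub_halvingStep`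
(V2′: the Sect. F halving step of [Balaban1985Variational] Prop. 8 at the d = 3 carriers, one `B₃ > 4`) and `stub_prop7From14` (V3: Prop. 7 from a background (14), for
every `B₃ > 4`) VERBATIM; conclusion = the registered text of `stub_thm1GlobalMin` VERBATIM.  Chain: ★r1 g4's `thm1In8GlobalMin_of_v7Leaves` (V2′ ∧ V3 ⟹ T8's text)
then `thm1GlobalMin_of_thm1In8`. [cite: Balaban1985Variational, Thm 1 (8) p.279, Prop. 7 p.299, Prop. 8 p.304] -/
theorem thm1GlobalMin_of_v7Leaves
    (hV2 : ∀ (L : ℕ), 1 < L → ∃ B₃ : ℝ, 4 < B₃ ∧ ∃ a₅ : ℝ, 0 < a₅ ∧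
      ∀ (i : Idx L) (ε₀ ε₁ : ℝ), 0 < ε₁ → ∀ (V : (famX L i).Bdry) (U : (famX L i).Cfg), (famX L i).Reg7 ε₁ V → (famX L i).InU ε₀ U →
        (famX L i).InB V U → (famX L i).IsCritical V U → ε₀ ≤ a₅ → (famX L i).InU (max (B₃ * ε₁) (ε₀ / 2)) U)
    (hV3 : ∀ (L : ℕ), 1 < L → ∀ B₃ : ℝ, 4 < B₃ →
      ∃ a₀ a₁' O₁ : ℝ, 0 < a₀ ∧ 0 < a₁' ∧ 1 ≤ O₁ ∧ ∀ (i : Idx L) (ε₀ ε₁ : ℝ), 0 < ε₁ → ∀ V : (famX L i).Bdry, (famX L i).Reg7 ε₁ V →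
        ∀ U₀ : (famX L i).Cfg, (famX L i).InU ((L : ℝ) ^ 3 * B₃ * ε₁) U₀ → (famX L i).InB V U₀ →
          (ε₀ ≤ a₀ → B₃ * ε₁ ≤ ε₀ → (famX L i).AtMostOneCriticalOrbit ε₀ V) ∧
          (ε₁ ≤ a₁' → ∃ U : (famX L i).Cfg, (famX L i).OnMinimalOrbit (O₁ * (L : ℝ) ^ 3 * B₃ * ε₁) V U)) :
    ∀ L : ℕ, Odd L → 1 < L → T3PrintedMinimiserExistence.Thm1GlobalMin L :=
  thm1GlobalMin_of_thm1In8 (thm1In8GlobalMin_of_v7Leaves hV2 hV3)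

end Summit.QuantumFields.YangMills.Theorems.InteriorExcision

end
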